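import Summits.ResolutionOfSingularities.ResolutionOfSingularities.Theorems.FrobeniusClosingSteerMaxGenExists
import Literature.AlgebraicGeometry.Resolution.InseparableLocalUniformizationDescent
import HarnessLib

/-!
# Crux `Steer` (stmt-ResolutionOfSingularities-16345), line `switching_dichotomy`: the MODEL STEP of the log-final
# exit E1 — a regular `p`-th-root closure of the local ring at the centre gives a regular model

OURS (campaign `res-hironaka`, rung L, slot W4.1, chain W4.1, lead `res-L0-w41-lead-1` g3; replaces the role of no
printed item; NOT a statement of the manuscript under review). Registered stub served: `stub_logFinalExitM` (skeleton
r18/r19, res-L0-w41-idea-2's model form `LogFinalExitM`), E1 branch, LAST STEP of res-L0-w41-idea-2's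
`PLAN-LogFinalExitM.md` §1 L4 («MODEL: `A :=` integral closure of `A₁[t]` in `K` — finitely generated, `A₀ ≤ A₁ ≤ A ∋ t`,
`A ⊆ O`, `Frac A = K`, and the local ring of `A` at the centre of `O` is `B′` — regular»).

* `IntegralClosureModel.concl_of_pthRootClosure` — for a finitely generated model `A₀ ≤ A₁ ⊆ O` of the base with
  `t ^ p ∈ A₀` (`p ≠ 0`) and `Frac (A₀[t]) = K`, write `S := (A₁)_{𝔪_O ∩ A₁} ⊆ K`; if a subring `C ⊆ K` with
  `C = {x | x ^ p ∈ S}` containing every element of `K` integral over `S` is a REGULAR LOCAL ring, then `(A₀, t)`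
  has a regular model: the integral closure `Ā` of `A₁` in `K` is a finitely generated `k`-algebra (E. Noether,
  tree `MaxGenExists.module_finite_integralClosure_model`, res-L0-w41-stub-10 p496225), lies in `O` (its elements have
  `p`-th powers in `S ⊆ O`), contains `A₀` and `t`, has fraction field `K`, and its local ring at the centre of `O`
  is `C` itself (`locAtCentre Ā O = C`: a fraction `y / z` of integral elements with `v z = 0` has `p`-th power in
  `S`; conversely `x ^ p = a / c` with `v c = 0` makes `c x` integral over `A₁`), hence regular.

Vocabulary (`Concl`) UNFOLDED verbatim; Theses-free. [cite: Liu2002, Prop. 4.1.27, p. 122]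
[cite: NovacoskiSpivakovsky2014, Lemma 2.5] [folklore]
-/

noncomputable section

-- `Summit.<S>.<S>.…` duplicates the summit name by design (single-problem summit).
set_option linter.dupNamespace false

open IsLocalRing Polynomial

namespace Summit.ResolutionOfSingularities.ResolutionOfSingularities.Theorems.SwitchingDichotomy

open Literature.AlgebraicGeometry.Resolution

namespace IntegralClosureModel

variable {k K : Type} [Field k] [Field K] [Algebra k K]

/-- `c * x` is integral over `A₁` as soon as `x ^ (m + 1) = a / c` with `a, c ∈ A₁`, `c ≠ 0`: it is a root of
`X ^ (m + 1) - c ^ m a`. [folklore] -/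
theorem isIntegral_mul_of_pow_eq_div (A₁ : Subalgebra k K) {x a c : K} (ha : a ∈ A₁) (hc : c ∈ A₁)
    (hc0 : c ≠ 0) {m : ℕ} (hx : x ^ (m + 1) = a / c) : IsIntegral A₁ (c * x) := by
  have hmem : c ^ m * a ∈ A₁ := A₁.mul_mem (A₁.pow_mem hc m) ha
  refine ⟨X ^ (m + 1) - Polynomial.C (⟨c ^ m * a, hmem⟩ : A₁), monic_X_pow_sub_C _ (Nat.succ_ne_zero m), ?_⟩
  rw [eval₂_sub, eval₂_X_pow, eval₂_C, sub_eq_zero, mul_pow, hx]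
  change c ^ (m + 1) * (a / c) = c ^ m * a
  rw [pow_succ]
  field_simp

/-- An element of `A₁` is integral over `A₁`. [folklore] -/
theorem isIntegral_of_mem (A₁ : Subalgebra k K) {x : K} (hx : x ∈ A₁) : IsIntegral A₁ x :=
  (isIntegral_algebraMap (R := A₁) (A := K) (x := ⟨x, hx⟩))

/-- Integrality over `A₁` passes to integrality over any larger subring `S ⊇ A₁` of `K` (push the monic equation along
the inclusion). [folklore] -/
theorem isIntegral_of_le {A₁ : Subalgebra k K} {S : Subring K} (h : A₁.toSubring ≤ S) {x : K}
    (hx : IsIntegral A₁ x) : IsIntegral S x := by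
  obtain ⟨q, hq, hqx⟩ := hx
  let φ : A₁ →+* S :=
    { toFun := fun a => ⟨(a : K), h a.2⟩
      map_one' := rfl
      map_mul' := fun _ _ => rfl
      map_zero' := rfl
      map_add' := fun _ _ => rfl }
  refine ⟨q.map φ, hq.map φ, ?_⟩
  rw [Polynomial.eval₂_map]
  exact hqx

/-- **The model step of the log-final exit E1.** See the module docstring. [cite: Liu2002, Prop. 4.1.27, p. 122]
[cite: NovacoskiSpivakovsky2014, Lemma 2.5] [folklore] -/
theorem concl_of_pthRootClosure (O : ValuationSubring K) (A₀ A₁ : Subalgebra k K)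
    (h₁ : A₁.toSubring ≤ O.toSubring) (t : K) {p : ℕ} (hp : p ≠ 0) (hle : A₀ ≤ A₁) (hfg₁ : A₁.FG)
    (htp : t ^ p ∈ A₀) (hfr : IsFractionRing (Algebra.adjoin k (insert t (A₀ : Set K))) K)
    (C : Subring K) (hCp : ∀ x : K, x ∈ C ↔ x ^ p ∈ locAtCentre A₁.toSubring O)
    (hCi : ∀ x : K, IsIntegral (locAtCentre A₁.toSubring O) x → x ∈ C) (hreg : IsRegularLocalRing C) :
    ∃ (A : Subalgebra k K) (h : A.toSubring ≤ O.toSubring), A₀ ≤ A ∧ t ∈ A ∧ A.FG ∧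
      IsFractionRing A K ∧ IsRegularLocalRing (Localization.AtPrime
        (Ideal.comap (Subring.inclusion h) (IsLocalRing.maximalIdeal O))) := by
  classical
  obtain ⟨m, rfl⟩ := Nat.exists_eq_succ_of_ne_zero hp
  -- ### (1) the integral closure `Ā` of `A₁` in `K`, as a `k`-subalgebra; finitely generated by E. Noether
  have htp₁ : t ^ (m + 1) ∈ A₁ := hle htp
  haveI := hfr
  have hfr₁ : IsFractionRing (Algebra.adjoin k (insert t (A₁ : Set K))) K :=
    isFractionRing_subalgebra_of_le (Algebra.adjoin k (insert t (A₀ : Set K))) _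
      (Algebra.adjoin_mono (Set.insert_subset_insert hle))
  have hfin : Module.Finite A₁ (integralClosure A₁ K) :=
    MaxGenExists.module_finite_integralClosure_model A₁ hfg₁ (Nat.succ_ne_zero m) htp₁ hfr₁
  set Abar : Subalgebra k K := (integralClosure A₁ K).restrictScalars k with hAbar_def
  have hmemAbar : ∀ {x : K}, x ∈ Abar ↔ IsIntegral A₁ x := fun {x} => Iff.rfl
  have hA₁Abar : A₁ ≤ Abar := fun x hx => hmemAbar.mpr (isIntegral_of_mem A₁ hx)
  have hfgAbar : Abar.FG := by
    haveI : Algebra.FiniteType k A₁ := (Subalgebra.fg_iff_finiteType A₁).mp hfg₁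
    haveI := hfin
    haveI : Algebra.FiniteType A₁ (integralClosure A₁ K) := inferInstance
    have hft : Algebra.FiniteType k (integralClosure A₁ K) := Algebra.FiniteType.trans (S := A₁) ‹_› ‹_›
    exact (Subalgebra.fg_iff_finiteType Abar).mpr hft
  -- ### (2) `Ā ⊆ C`, hence `Ā ⊆ O` (p-th powers lie in `S ⊆ O`)
  have hS_O : locAtCentre A₁.toSubring O ≤ O.toSubring := locAtCentre_le h₁
  have hA₁S : A₁.toSubring ≤ locAtCentre A₁.toSubring O := le_locAtCentre A₁.toSubring O
  have hAbarC : ∀ {x : K}, x ∈ Abar → x ∈ C := fun hx => hCi _ (isIntegral_of_le hA₁S (hmemAbar.mp hx))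
  have hAbarO : Abar.toSubring ≤ O.toSubring := fun x hx =>
    Literature.AlgebraicGeometry.Resolution.mem_valuationSubring_of_pow_mem O (Nat.succ_pos m)
      (hS_O ((hCp x).mp (hAbarC hx)))
  -- ### (3) `t ∈ Ā`, `A₀ ≤ Ā`, `Frac Ā = K`
  have htAbar : t ∈ Abar := by
    refine hmemAbar.mpr ⟨X ^ (m + 1) - Polynomial.C (⟨t ^ (m + 1), htp₁⟩ : A₁),
      monic_X_pow_sub_C _ (Nat.succ_ne_zero m), ?_⟩
    rw [eval₂_sub, eval₂_X_pow, eval₂_C, sub_eq_zero]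
    rfl
  have hA₀Abar : A₀ ≤ Abar := hle.trans hA₁Abar
  have hfrAbar : IsFractionRing Abar K :=
    isFractionRing_subalgebra_of_le (Algebra.adjoin k (insert t (A₀ : Set K))) Abar
      (Algebra.adjoin_le (Set.insert_subset htAbar fun x hx => hA₀Abar hx))
  refine ⟨Abar, hAbarO, hA₀Abar, htAbar, hfgAbar, hfrAbar, ?_⟩
  -- ### (4) the local ring of `Ā` at the centre of `O` is `C`
  have hloc : locAtCentre Abar.toSubring O = C := by
    refine le_antisymm ?_ ?_
    · rintro _ ⟨y, hy, z, hz, hvz, rfl⟩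
      have hyS : y ^ (m + 1) ∈ locAtCentre A₁.toSubring O := (hCp y).mp (hAbarC hy)
      have hzS : z ^ (m + 1) ∈ locAtCentre A₁.toSubring O := (hCp z).mp (hAbarC hz)
      have hvzp : O.valuation (z ^ (m + 1)) = 1 := by rw [map_pow, hvz, one_pow]
      refine (hCp _).mpr ?_
      rw [div_pow, div_eq_mul_inv]
      exact Subring.mul_mem _ hyS (inv_mem_locAtCentre hzS hvzp)
    · intro x hx
      obtain ⟨a, ha, c, hc, hvc, hxp⟩ := mem_locAtCentre_iff.mp ((hCp x).mp hx)
      have hc0 := ne_zero_of_valuation_eq_one hvc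
      have hcx : c * x ∈ Abar := hmemAbar.mpr (isIntegral_mul_of_pow_eq_div A₁ ha hc hc0 hxp)
      exact mem_locAtCentre_iff.mpr ⟨c * x, hcx, c, hA₁Abar hc, hvc, by field_simp⟩
  have hregL : IsRegularLocalRing (locAtCentre Abar.toSubring O) := by
    rw [hloc]
    exact hreg
  exact (isRegularLocalRing_locAtCentre_iff hAbarO).mp hregL

end IntegralClosureModel

end Summit.ResolutionOfSingularities.ResolutionOfSingularities.Theorems.SwitchingDichotomy

end
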